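/-
Copyright (c) 2026 the pub-hodgecm-mathlib formalisation cell (harness21).  Prover seat hodgecm-mathlib-LH4-p06 (g4), Track A «(D-RAM) FOUR-FRAME», unit U2H, census leaf
(ρ2b′-X) — T5c «TORIC LEVEL CENSUS, M∕E-RAMIFIED»: the norm-depth index `I = [U_M : B]` when BOTH `M ∕ E` and `M ∕ K♮` are ramified (type RamM); the twin of F0P3-p01 (g32)'s
★ p857360 `QuadraticOrderNormDepthIndexTwo` §3–§4 (type RamK, `M ∕ E` unramified) — his RamM index-lemma list items (L-RM3)∕(L-RM5), then «open», closed.  2026-09-04.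
-/
import Literature.NumberTheory.LocalFields.QuadraticOrderNormDepthIndexTwo       -- ★ p857360 (F0P3-p01 (g32)): `mem_map_normHom_iff`, `map_normHom_units_relIndex_eq_two`; brings ★ `relIndex_comap_eq_div_two_of_le` ∕ `relIndex_comap_eq_of_not_le` (p857339), ★ `exists_mul_map_eq_of_approx` (p856861), ★ `exists_fixed_unit_not_norm_of_level_pow`, ★ `coe_normHom` (p857299)
import Literature.NumberTheory.LocalFields.QuadraticOrderTorusIndicesRamified    -- ★ p857338 (this seat): `v_eq_one_iff_of_le_iff`, `relIndex_thetaFixed_depth_eq_pow_of_le_iff` (even levels along an order-compatible `jK`)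
import Literature.NumberTheory.LocalFields.QuadraticOrderTorusIndices            -- ★ p857349 (LH4-p08 (g4)) ED. 2: `relIndex_thetaFixed_depth_odd_eq_pow` (odd levels along an order-compatible `jK`)
import Literature.NumberTheory.LocalFields.WildQuadraticDatumTrace               -- ★ `map_varpi_ne`, `even_log_v_of_fixed`; brings ★ `exists_fixed_coords_of_map_ne`, `v_fixed_add_fixed_mul_eq_max`, `v_fixed_add_fixed_mul_le_one_iff` (Eisenstein coordinates)
import Literature.NumberTheory.LocalFields.ValuedCompleteIsAdicComplete          -- ★ `isAdicComplete_valuedInteger_of_completeSpace`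
import HarnessLib

/-!
# The norm-depth index with a norm image of index two, `M ∕ E` RAMIFIED: `[U_M : B] = [Ũ : Ṽ] ∕ 2` at `K♮`-level `k ≥ dΘ − 1`, `= [Ũ : Ṽ]` below (type RamM)
(Serre, *Local Fields* Ch. V §3 Cor. 3 (norm subgroup of index two, conductor); Ch. IV §1 Prop. 3–4 (`i(σ) = d`); Flicker 1998 p. 84 (unit indices of the orders))

Topic `NumberTheory/LocalFields`; namespace `Literature.NumberTheory.LocalFields.QuadraticOrder`.  THEOREMS ONLY (no definition, no instance, no notation, no named fact, no
`sorry`); kernel lane `--supports stmt-HodgeConjecture-24833` (count-neutral).  Cell `pub/hodgecm-mathlib` (D-0151), crux H413, Track A, unit U2H, census leaf (ρ2b′-X): TYPE RamM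
of the toric census (this seat's T5c memo and sheet v5; ★ HEAD p857418 `Theorems/F0P3cDyRamToricLevelCensusRamM` counts `#levelSet(j,a)` as `[B : H] − [B′ : H]` and in the
index form `q^j·([U : B′] − [U : B])∕([U : B][U : B′])`).  The one number left symbolic there is the NORM-DEPTH INDEX `I = [U_M : B]`, `B = {ω : |ω| = 1, |ωΘω − ρ(ωΘω)| ≤ r}`
(F0P3-p01 (g32) RamM INDEX-LEMMAS v1 (L-RM3)∕(L-RM5): «`I(c)` depends on BOTH `d_E` and `d_{K♮}` … treat as OPEN»).  ★ p857360 computes `I` for type RamK (`M ∕ E` UNRAMIFIED,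
`|α − ρα| = 1`, `ρϖ = ϖ`); HERE `M ∕ E` and `M ∕ K♮` are both ramified, the third field `K♮ = M^Θ` is a valued field `K′` of its own with a ramified quadratic datum `(σ′, π′, d′)`
(`σ′ = ρ|K♮`, `d′ = v_{K♮}(π′ − σ′π′)` = the different exponent of `K♮ ∕ F`), embedded by an ORDER-COMPATIBLE `jK : K′ →+* M` onto the `Θ`-fixed elements (`|jK π′| = exp(−2)`:
`M ∕ K♮` ramified) — the frame of ★ p857338 ∕ ★ p857349.  With `Ũ = {Θz = z, |z| = 1}`, `Ṽ = Ũ ∩ {|z − ρz| ≤ |jK π′^{d′+k}|}` (`K♮`-LEVEL `k`) and the `Θ`-datum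
`(M, Θ, ϖ, dΘ, t)`:
* §1 (on `K′`) `v_sub_map_le_mul_pow` — THE DIFFERENT BOUND `|t − σ′t| ≤ |t|·|π′|^{d′−1}`; **`exists_fixed_mul_of_unit_depth`** — `Ṽ′_{d′+k} = 𝒪_Fˣ·U_{K′}^{(k+1)}` elementwise
  (`z = f·w`, `σ′f = f`, `|w − 1| ≤ |π′|^{k+1}`; Eisenstein coordinates `z = a + bπ′`, ★ `exists_fixed_coords_of_map_ne`, parity ★ `v_fixed_add_fixed_mul_eq_max`) — the
  RAMIFIED-order counterpart of ★ p857302's `Ṽ_c = 𝒪_Fˣ·Ṽ′_{⌈c∕2⌉}`; `v_sub_map_le_pow_of_unit` — levels `≤ d′` are automatic.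
* §2 (on `M`) THE THRESHOLD: `Ṽ ≤ N(U_M)` when `dΘ ≤ k + 1` (`exists_mul_map_eq_of_thetaFixed_depth_of_le`: `w ≡ 1 (π′^{k+1})` is `≡ 1 (ϖ^{2k+2})`, `2k + 2 ≥ 2dΘ − 1`, ★ norms
  above the conductor; the doubly fixed unit `f` by the base-unit token `hFN`), and `Ṽ ≰ N(U_M)` when `k + 2 ≤ dΘ` (`exists_thetaFixed_depth_not_norm_of_le`: the ★ non-norm
  `Θ`-fixed unit of `K♮`-level `k + 1 ≤ dΘ − 1` lies in `Ṽ` by the different bound).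
* §3 **`relIndex_normDepth_eq_ite_of_index_two_ramified`** — `[U : B] = if dΘ ≤ k + 1 then [Ũ : Ṽ] ∕ 2 else [Ũ : Ṽ]` (★ pull-back bookkeeping + ★ `[Ũ : N(U_M)] = 2`); with Mars'
  index along `jK` (★ p857338 even `k = 2m`: `q^m`; ★ p857349 odd `k = 2m+1`: `q^{m+1}`): **`relIndex_normDepth_eq_ite_pow_of_ramified`** `[U : B] = if dΘ ≤ 2m+1 then q^m∕2
  else q^m`, **`relIndex_normDepth_odd_eq_ite_pow_of_ramified`**; and `relIndex_normDepth_eq_one_of_le` — at `M`-depth `|jK π′^n|`, `n ≤ d′`, `B = U`.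
CHECK (g32's §B data, q = 2, `I(c)` for `c = 0…9`, M-depth `2c + d_ρ = 2(d′ + k)`): cells A∕B `(d_ρ, dΘ, d′) = (4,2,3)` → `1,1,1,1,2,2,4,4,8,8`; C `(2,4,2)` → `1,1,2,2,2,2,4,4,8,8`;
D `(2,2,3)` → `1,1,1,1,1,2,2,4,4,8` — 30∕30 (D's «excess» is `d′ = 3` against `d_ρ = 2`, no new invariant).
HONEST LABEL: HC_CM is proved only modulo the 7 printed citations (2 remaining named inputs: hLiu418 = stmt-HodgeConjecture-24832, h413 = stmt-HodgeConjecture-24833) until rung 0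
closes; unconditional local algebra, count-neutral (the RamM index organ; no census value asserted).

## References
* [Serre1979] J.-P. Serre, *Local Fields*, GTM 67 (1979): Ch. V §3 Cor. 3 (norm subgroup of index two, conductor), Ch. IV §1 Prop. 3–4 (`i_G(σ) = ord(σπ − π)`), Ch. I §6
  Prop. 18 (Eisenstein basis).
* [Flicker1998UnitaryFL] Y. Z. Flicker, *Elementary proof of the fundamental lemma for a unitary group*, Canad. J. Math. 50 (1998): p. 84 (unit indices of the orders), §6 p. 95.
-/

set_option autoImplicit false

open WithZero IsLocalRing
open scoped Valued
open Literature.NumberTheory.Automorphic.UnitaryThreeFourFrame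
open Literature.NumberTheory.LocalFields.WildQuadraticDatum

namespace Literature.NumberTheory.LocalFields.QuadraticOrder

/-! ## §1 On the third field `K′ = K♮`: the different bound and the factorisation `Ṽ′_{d′+k} = 𝒪_Fˣ·U^{(k+1)}` -/

section ThirdField

variable {K' : Type*} [Field K'] [Valued K' ℤᵐ⁰] {σ' : K' →+* K'} {π' : K'} {d' : ℕ}

/-- A ramified quadratic datum has `d′ ≥ 1`: `|π′ − σ′π′| ≤ |π′| < 1 = |π′|^0`. [cite: Serre1979, Ch. IV §1 Prop. 3–4] -/
theorem one_le_of_v_sub_map_eq_pow (hvσ' : ∀ x, Valued.v (σ' x) = Valued.v x) (hπ' : Valued.v π' = exp (-1 : ℤ))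
    (hdd' : Valued.v (π' - σ' π') = Valued.v π' ^ d') : 1 ≤ d' := by
  by_contra h
  have hd0 : d' = 0 := by omega
  rw [hd0, pow_zero] at hdd'
  have hle : Valued.v (π' - σ' π') ≤ exp (-1 : ℤ) := (Valuation.map_sub _ _ _).trans (max_le hπ'.le (by rw [hvσ', hπ']))
  rw [hdd', ← exp_zero, exp_le_exp] at hle
  omega

/-- **THE DIFFERENT BOUND `|t − σ′t| ≤ |t|·|π′|^{d′−1}`** (`σ′` moves every element by `d′ − 1` extra levels, `i(σ′) = d′`): in Eisenstein coordinates `t = a + bπ′` (`σ′`-fixed `a, b`),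
`t − σ′t = b(π′ − σ′π′)` and `|bπ′| ≤ |t|` (parity, ★ `v_fixed_add_fixed_mul_eq_max`). [cite: Serre1979, Ch. IV §1 Prop. 3–4] -/
theorem v_sub_map_le_mul_pow (hσ' : ∀ x, σ' (σ' x) = x) (hvσ' : ∀ x, Valued.v (σ' x) = Valued.v x)
    (hfix' : ∀ x : K', σ' x = x → x ≠ 0 → ∃ n : ℤ, Valued.v x = exp (2 * n)) (hπ' : Valued.v π' = exp (-1 : ℤ))
    (hdd' : Valued.v (π' - σ' π') = Valued.v π' ^ d') (t : K') :
    Valued.v (t - σ' t) ≤ Valued.v t * Valued.v π' ^ (d' - 1) := by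
  have hd1 := one_le_of_v_sub_map_eq_pow hvσ' hπ' hdd'
  obtain ⟨a, b, ha, hb, rfl⟩ := exists_fixed_coords_of_map_ne hσ' (map_varpi_ne hπ' hdd') t
  have hsub : a + b * π' - σ' (a + b * π') = b * (π' - σ' π') := by rw [map_add, map_mul, ha, hb]; ring
  have hmax := v_fixed_add_fixed_mul_eq_max (WildQuadraticDatum.even_log_v_of_fixed hfix') hπ' ha hb
  have hbt : Valued.v b * Valued.v π' ≤ Valued.v (a + b * π') := by rw [hmax, hπ']; exact le_max_right _ _
  rw [hsub, map_mul, hdd']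
  calc Valued.v b * Valued.v π' ^ d' = Valued.v b * Valued.v π' * Valued.v π' ^ (d' - 1) := by
        rw [mul_assoc, ← pow_succ', Nat.sub_add_cancel hd1]
    _ ≤ Valued.v (a + b * π') * Valued.v π' ^ (d' - 1) := mul_le_mul' hbt le_rfl

/-- **`Ṽ′_{d′+k} = 𝒪_Fˣ · U^{(k+1)}`, ELEMENTWISE**: a unit `z` of `K′` with `|z − σ′z| ≤ |π′|^{d′+k}` is `f·w` with `σ′f = f`, `|f| = 1`, `|w − 1| ≤ |π′|^{k+1}` — Eisenstein
coordinates `z = a + bπ′`: `|a| = 1` (parity), `|b|·|π′|^{d′} = |z − σ′z| ≤ |π′|^{d′+k}`, `f = a`, `w = 1 + (b∕a)π′`.  The RAMIFIED-order counterpart of ★ p857302's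
`Ṽ_c = 𝒪_Fˣ·Ṽ′_{⌈c∕2⌉}` (`K♮ ∕ F` unramified there). [cite: Serre1979, Ch. V §3] [cite: Flicker1998UnitaryFL, p. 84] -/
theorem exists_fixed_mul_of_unit_depth (hσ' : ∀ x, σ' (σ' x) = x)
    (hfix' : ∀ x : K', σ' x = x → x ≠ 0 → ∃ n : ℤ, Valued.v x = exp (2 * n)) (hπ' : Valued.v π' = exp (-1 : ℤ))
    (hdd' : Valued.v (π' - σ' π') = Valued.v π' ^ d') {k : ℕ} {z : K'} (hz1 : Valued.v z = 1)
    (hzk : Valued.v (z - σ' z) ≤ Valued.v π' ^ (d' + k)) :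
    ∃ f w : K', σ' f = f ∧ Valued.v f = 1 ∧ Valued.v (w - 1) ≤ Valued.v π' ^ (k + 1) ∧ z = f * w := by
  obtain ⟨a, b, ha, hb, rfl⟩ := exists_fixed_coords_of_map_ne hσ' (map_varpi_ne hπ' hdd') z
  have hmax := v_fixed_add_fixed_mul_eq_max (WildQuadraticDatum.even_log_v_of_fixed hfix') hπ' ha hb
  -- parity: `|b|·exp(−1) ≠ 1`, hence `|a| = 1`
  have hb1 : Valued.v b * exp (-1 : ℤ) ≠ 1 := by
    rcases eq_or_ne b 0 with rfl | hb0
    · rw [map_zero, zero_mul]; exact zero_ne_one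
    obtain ⟨n, hn⟩ := hfix' b hb hb0
    rw [hn, ← exp_add, ← exp_zero, Ne, exp_inj]; omega
  have ha1 : Valued.v a = 1 := by
    rcases max_choice (Valued.v a) (Valued.v b * exp (-1 : ℤ)) with h | h
    · rw [← h, ← hmax, hz1]
    · exact absurd (by rw [← h, ← hmax, hz1]) hb1.symm
  have ha0 : a ≠ 0 := (Valuation.ne_zero_iff _).1 (by rw [ha1]; exact one_ne_zero)
  have hπ0 : 0 < Valued.v π' := zero_lt_iff.2 (by rw [hπ']; exact exp_ne_zero)
  -- depth: `|b|·|π′|^{d′} ≤ |π′|^{d′}·|π′|^k`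
  have hsub : a + b * π' - σ' (a + b * π') = b * (π' - σ' π') := by rw [map_add, map_mul, ha, hb]; ring
  have hzk' : Valued.v π' ^ d' * Valued.v b ≤ Valued.v π' ^ d' * Valued.v π' ^ k := by
    rwa [hsub, map_mul, hdd', pow_add, mul_comm (Valued.v b)] at hzk
  have hbk : Valued.v b ≤ Valued.v π' ^ k := le_of_mul_le_mul_left hzk' (pow_pos hπ0 _)
  refine ⟨a, 1 + b / a * π', ha, ha1, ?_, ?_⟩
  · rw [add_sub_cancel_left, map_mul, map_div₀, ha1, div_one, pow_succ]
    exact mul_le_mul' hbk le_rfl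
  · rw [mul_add, mul_one, ← mul_assoc, mul_div_cancel₀ b ha0]

/-- **LEVELS `≤ d′` ARE AUTOMATIC**: every integral `z` of `K′` has `|z − σ′z| ≤ |π′|^{d′}` (coordinates: `|b| ≤ 1` by ★ `v_fixed_add_fixed_mul_le_one_iff`).
[cite: Serre1979, Ch. IV §1 Prop. 3–4] -/
theorem v_sub_map_le_pow_of_v_le_one (hσ' : ∀ x, σ' (σ' x) = x)
    (hfix' : ∀ x : K', σ' x = x → x ≠ 0 → ∃ n : ℤ, Valued.v x = exp (2 * n)) (hπ' : Valued.v π' = exp (-1 : ℤ))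
    (hdd' : Valued.v (π' - σ' π') = Valued.v π' ^ d') {z : K'} (hz1 : Valued.v z ≤ 1) :
    Valued.v (z - σ' z) ≤ Valued.v π' ^ d' := by
  obtain ⟨a, b, ha, hb, rfl⟩ := exists_fixed_coords_of_map_ne hσ' (map_varpi_ne hπ' hdd') z
  have hb1 : Valued.v b ≤ 1 := ((v_fixed_add_fixed_mul_le_one_iff (WildQuadraticDatum.even_log_v_of_fixed hfix') hπ' ha hb).1 hz1).2
  have hsub : a + b * π' - σ' (a + b * π') = b * (π' - σ' π') := by rw [map_add, map_mul, ha, hb]; ring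
  rw [hsub, map_mul, hdd']
  calc Valued.v b * Valued.v π' ^ d' ≤ 1 * Valued.v π' ^ d' := mul_le_mul' hb1 le_rfl
    _ = Valued.v π' ^ d' := one_mul _

end ThirdField

/-! ## §2 On `M`: transport along the order-compatible `jK` and the threshold `dΘ ≤ k + 1` -/

section Threshold

variable {K : Type} [Field K] [Valued K ℤᵐ⁰] {ρ Θ : K →+* K}
  {K' : Type*} [Field K'] [Valued K' ℤᵐ⁰] {σ' : K' →+* K'} {π' : K'} {d' : ℕ}

/-- Order-compatibility on power levels: `|jK x| ≤ |jK π′^n| ↔ |x| ≤ |π′|^n`. [cite: Serre1979, Ch. II §2] -/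
theorem v_map_le_iff_of_le_iff (jK : K' →+* K) (hjle : ∀ x y : K', Valued.v (jK x) ≤ Valued.v (jK y) ↔ Valued.v x ≤ Valued.v y)
    (x : K') (n : ℕ) : Valued.v (jK x) ≤ Valued.v (jK π' ^ n) ↔ Valued.v x ≤ Valued.v π' ^ n := by
  rw [← map_pow jK, hjle, map_pow]

omit [Valued K' ℤᵐ⁰] in
/-- The scale of the embedding: `|jK π′| = exp(−2) = |ϖ|^2` for the `M`-uniformiser `ϖ` of the `Θ`-datum (`M ∕ K♮` ramified). [cite: Serre1979, Ch. II §2] -/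
theorem v_map_varpi_eq_sq (jK : K' →+* K) (hjπ : Valued.v (jK π') = exp (-2 : ℤ)) {ϖ : K} (hϖ : Valued.v ϖ = exp (-1 : ℤ)) :
    Valued.v (jK π') = Valued.v ϖ ^ 2 := by
  rw [hjπ, hϖ, ← exp_nsmul, nsmul_eq_mul]; norm_num

/-- **ABOVE THE THRESHOLD (`dΘ ≤ k + 1`) EVERY ELEMENT OF `Ṽ` IS A NORM `ωΘω`**: pull `z` back to `K′`, factor `z′ = f·w` (§1: `σ′f = f`, `|w − 1| ≤ |π′|^{k+1}`); `jK f` is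
doubly fixed, a norm by the base-unit token `hFN`; `jK w ≡ 1 (ϖ^{2k+2})` with `2k + 2 ≥ 2dΘ − 1` is a norm (★ norms above the conductor on `(M, Θ, ϖ, dΘ, t)`).
[cite: Serre1979, Ch. V §3 Cor. 3] -/
theorem exists_mul_map_eq_of_thetaFixed_depth_of_le [CompleteSpace K]
    (hσ' : ∀ x, σ' (σ' x) = x) (hfix' : ∀ x : K', σ' x = x → x ≠ 0 → ∃ n : ℤ, Valued.v x = exp (2 * n))
    (hπ' : Valued.v π' = exp (-1 : ℤ)) (hdd' : Valued.v (π' - σ' π') = Valued.v π' ^ d')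
    (jK : K' →+* K) (hjle : ∀ x y : K', Valued.v (jK x) ≤ Valued.v (jK y) ↔ Valued.v x ≤ Valued.v y) (hjΘ : ∀ x, Θ (jK x) = jK x)
    (hjfix : ∀ z : K, Θ z = z → ∃ x, jK x = z) (hjσ : ∀ x, jK (σ' x) = ρ (jK x)) (hjπ : Valued.v (jK π') = exp (-2 : ℤ))
    {ϖ : K} {dΘ t : ℕ} (hD : IsRamifiedQuadraticDatum Θ ϖ dΘ t)
    (hFN : ∀ f : K, ρ f = f → Θ f = f → Valued.v f = 1 → ∃ x : K, x * Θ x = f)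
    {k : ℕ} (hk : dΘ ≤ k + 1) {z : K} (hΘz : Θ z = z) (hz1 : Valued.v z = 1) (hzk : Valued.v (z - ρ z) ≤ Valued.v (jK π' ^ (d' + k))) :
    ∃ ω : K, ω * Θ ω = z := by
  have hϖ := hD.2.2.1
  have hjπ2 := v_map_varpi_eq_sq jK hjπ hϖ
  obtain ⟨z', rfl⟩ := hjfix z hΘz
  have hz1' : Valued.v z' = 1 := (v_eq_one_iff_of_le_iff jK hjle z').1 hz1
  have hzk' : Valued.v (z' - σ' z') ≤ Valued.v π' ^ (d' + k) := by
    rw [← v_map_le_iff_of_le_iff jK hjle, map_sub, hjσ]; exact hzk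
  obtain ⟨f, w, hσf, hf1, hw, rfl⟩ := exists_fixed_mul_of_unit_depth hσ' hfix' hπ' hdd' hz1' hzk'
  -- the doubly fixed unit `jK f` is a norm
  obtain ⟨x, hx⟩ := hFN (jK f) (by rw [← hjσ, hσf]) (hjΘ f) ((v_eq_one_iff_of_le_iff jK hjle f).2 hf1)
  -- `jK w ≡ 1 (ϖ^{2k+2})`
  have hw' : Valued.v (1 * Θ 1 - jK w) ≤ Valued.v (ϖ ^ (2 * (k + 1))) := by
    have h1 : (1 : K) * Θ 1 - jK w = -(jK (w - 1)) := by rw [map_one, map_sub, map_one]; ring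
    rw [h1, Valuation.map_neg, map_pow, pow_mul, ← hjπ2, ← map_pow]
    exact (v_map_le_iff_of_le_iff jK hjle (w - 1) (k + 1)).2 hw
  obtain ⟨y, hy⟩ := exists_mul_map_eq_of_approx hD (hjΘ w) (z := 1) (by rw [map_one]) (n := 2 * (k + 1)) (by omega) hw'
  exact ⟨x * y, by rw [map_mul jK, map_mul Θ, mul_mul_mul_comm, hx, hy]⟩

/-- **BELOW THE THRESHOLD (`k + 2 ≤ dΘ`) SOME ELEMENT OF `Ṽ` IS NOT A NORM**: the ★ non-norm `Θ`-fixed unit `u ≡ 1 (ϖ^{2(k+1)})` of `K♮`-level `k + 1 ≤ dΘ − 1` has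
`|u′ − 1| ≤ |π′|^{k+1}` in `K′`, hence `|u′ − σ′u′| ≤ |π′|^{k+1+d′−1}` by the different bound (§1), i.e. `u ∈ Ṽ`. [cite: Serre1979, Ch. V §3 Cor. 3] -/
theorem exists_thetaFixed_depth_not_norm_of_le [CompleteSpace K] [Finite 𝓀[K]]
    (hσ' : ∀ x, σ' (σ' x) = x) (hvσ' : ∀ x, Valued.v (σ' x) = Valued.v x) (hfix' : ∀ x : K', σ' x = x → x ≠ 0 → ∃ n : ℤ, Valued.v x = exp (2 * n))
    (hπ' : Valued.v π' = exp (-1 : ℤ)) (hdd' : Valued.v (π' - σ' π') = Valued.v π' ^ d')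
    (jK : K' →+* K) (hjle : ∀ x y : K', Valued.v (jK x) ≤ Valued.v (jK y) ↔ Valued.v x ≤ Valued.v y)
    (hjfix : ∀ z : K, Θ z = z → ∃ x, jK x = z) (hjσ : ∀ x, jK (σ' x) = ρ (jK x)) (hjπ : Valued.v (jK π') = exp (-2 : ℤ))
    {ϖ : K} {dΘ t : ℕ} (hD : IsRamifiedQuadraticDatum Θ ϖ dΘ t) {k : ℕ} (hk : k + 2 ≤ dΘ) :
    ∃ u : K, Θ u = u ∧ Valued.v u = 1 ∧ Valued.v (u - ρ u) ≤ Valued.v (jK π' ^ (d' + k)) ∧ ¬ ∃ ω : K, ω * Θ ω = u := by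
  have hϖ := hD.2.2.1
  have hjπ2 := v_map_varpi_eq_sq jK hjπ hϖ
  have hd1 := one_le_of_v_sub_map_eq_pow hvσ' hπ' hdd'
  haveI : IsAdicComplete 𝓂[K] 𝒪[K] := isAdicComplete_valuedInteger_of_completeSpace hϖ
  obtain ⟨u, hΘu, hu1, hu, huN⟩ := exists_fixed_unit_not_norm_of_level_pow Θ ϖ dΘ t hD (n := k + 1) (by omega)
  refine ⟨u, hΘu, hu1, ?_, huN⟩
  obtain ⟨u', rfl⟩ := hjfix u hΘu
  -- pull back: `|u′ − 1| ≤ |π′|^{k+1}`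
  have hu' : Valued.v (u' - 1) ≤ Valued.v π' ^ (k + 1) := by
    rw [← v_map_le_iff_of_le_iff jK hjle, map_sub, map_one, map_pow, hjπ2, ← pow_mul]
    rw [map_pow] at hu; exact hu
  -- the different bound on `t = u′ − 1`
  have hdiff := v_sub_map_le_mul_pow hσ' hvσ' hfix' hπ' hdd' (u' - 1)
  have heq : u' - 1 - σ' (u' - 1) = u' - σ' u' := by rw [map_sub, map_one]; ring
  rw [heq] at hdiff
  rw [← hjσ, ← map_sub, v_map_le_iff_of_le_iff jK hjle]
  refine hdiff.trans ?_
  calc Valued.v (u' - 1) * Valued.v π' ^ (d' - 1) ≤ Valued.v π' ^ (k + 1) * Valued.v π' ^ (d' - 1) := mul_le_mul' hu' le_rfl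
    _ = Valued.v π' ^ (d' + k) := by rw [← pow_add]; congr 1; omega

end Threshold

/-! ## §3 The index `[U_M : B]` (type RamM) -/

section Index

variable {K : Type} [Field K] [Valued K ℤᵐ⁰] {ρ Θ : K →+* K}
  {K' : Type*} [Field K'] [Valued K' ℤᵐ⁰] {σ' : K' →+* K'} {π' : K'} {d' : ℕ}

/-- **THE NORM-DEPTH INDEX WITH AN IMAGE OF INDEX TWO, `M ∕ E` RAMIFIED** (type RamM): for `U = {|ω| = 1}`, `Ũ = {Θz = z, |z| = 1}`, `Ṽ = Ũ ∩ {|z − ρz| ≤ |jK π′^{d′+k}|}`,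
`B = {|ω| = 1, |ωΘω − ρ(ωΘω)| ≤ |jK π′^{d′+k}|}`, the third field `K′` with its ramified datum `(σ′, π′, d′)` embedded order-compatibly by `jK` onto the `Θ`-fixed elements
(`jK∘σ′ = ρ∘jK`, `|jK π′| = exp(−2)`), the `Θ`-datum `(M, Θ, ϖ, dΘ, t)` over a complete field with finite residue field, and the base-unit token `hFN`:
**`[U : B] = [Ũ : Ṽ] ∕ 2` if `dΘ ≤ k + 1`, and `= [Ũ : Ṽ]` if `k + 2 ≤ dΘ`.** [cite: Serre1979, Ch. V §3 Cor. 3] [cite: Flicker1998UnitaryFL, p. 84] -/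
theorem relIndex_normDepth_eq_ite_of_index_two_ramified [CompleteSpace K] [Finite 𝓀[K]]
    (hσ' : ∀ x, σ' (σ' x) = x) (hvσ' : ∀ x, Valued.v (σ' x) = Valued.v x) (hfix' : ∀ x : K', σ' x = x → x ≠ 0 → ∃ n : ℤ, Valued.v x = exp (2 * n))
    (hπ' : Valued.v π' = exp (-1 : ℤ)) (hdd' : Valued.v (π' - σ' π') = Valued.v π' ^ d')
    (jK : K' →+* K) (hjle : ∀ x y : K', Valued.v (jK x) ≤ Valued.v (jK y) ↔ Valued.v x ≤ Valued.v y) (hjΘ : ∀ x, Θ (jK x) = jK x)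
    (hjfix : ∀ z : K, Θ z = z → ∃ x, jK x = z) (hjσ : ∀ x, jK (σ' x) = ρ (jK x)) (hjπ : Valued.v (jK π') = exp (-2 : ℤ))
    {ϖ : K} {dΘ t : ℕ} (hD : IsRamifiedQuadraticDatum Θ ϖ dΘ t)
    (hFN : ∀ f : K, ρ f = f → Θ f = f → Valued.v f = 1 → ∃ x : K, x * Θ x = f)
    (k : ℕ) (U Ut Vt B : Subgroup Kˣ) (hU : ∀ u, u ∈ U ↔ Valued.v (u : K) = 1)
    (hUt : ∀ z, z ∈ Ut ↔ Θ (z : K) = z ∧ Valued.v (z : K) = 1)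
    (hVt : ∀ z, z ∈ Vt ↔ Θ (z : K) = z ∧ Valued.v (z : K) = 1 ∧ Valued.v ((z : K) - ρ z) ≤ Valued.v (jK π' ^ (d' + k)))
    (hB : ∀ ω, ω ∈ B ↔ Valued.v (ω : K) = 1 ∧ Valued.v ((ω : K) * Θ ω - ρ ((ω : K) * Θ ω)) ≤ Valued.v (jK π' ^ (d' + k))) :
    B.relIndex U = if dΘ ≤ k + 1 then Vt.relIndex Ut / 2 else Vt.relIndex Ut := by
  -- adapted from ★ p857360 `relIndex_normDepth_eq_ite_of_index_two` (F0P3-p01 (g32)), the two threshold calls replaced by §2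
  have hΘΘ := hD.1; have hvΘ := hD.2.1
  set N : Kˣ →* Kˣ := MonoidHom.id Kˣ * Units.map (Θ : K →* K) with hN
  have hNval : ∀ ω : Kˣ, ((N ω : Kˣ) : K) = (ω : K) * Θ ω := fun ω => coe_normHom ω
  have hNΘ : ∀ ω : Kˣ, Θ (((N ω : Kˣ) : K)) = ((N ω : Kˣ) : K) := fun ω => by rw [hNval, map_mul, hΘΘ, mul_comm]
  have hN1 : ∀ {ω : Kˣ}, Valued.v (ω : K) = 1 → Valued.v (((N ω : Kˣ) : K)) = 1 := fun hω => by rw [hNval, map_mul, hvΘ, hω, mul_one]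
  -- `B = N⁻¹ Ṽ ⊓ U`
  have hBeq : B = (Vt.comap N) ⊓ U := by
    ext ω
    rw [hB, Subgroup.mem_inf, Subgroup.mem_comap, hVt, hU]
    constructor
    · rintro ⟨h1, h2⟩
      exact ⟨⟨hNΘ ω, hN1 h1, by rw [hNval]; exact h2⟩, h1⟩
    · rintro ⟨⟨-, -, h2⟩, h1⟩
      rw [hNval] at h2
      exact ⟨h1, h2⟩
  -- `N(U) ≤ Ũ` with index `2`, `Ṽ ≤ Ũ`
  have hle : U.map N ≤ Ut := by
    rintro _ ⟨ω, hω, rfl⟩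
    exact (hUt _).2 ⟨hNΘ ω, hN1 ((hU ω).1 hω)⟩
  have h2 : (U.map N).relIndex Ut = 2 := map_normHom_units_relIndex_eq_two hD hU hUt
  have hVA : Vt ≤ Ut := fun z hz => (hUt z).2 ⟨((hVt z).1 hz).1, ((hVt z).1 hz).2.1⟩
  rw [hBeq, Subgroup.inf_relIndex_right]
  split_ifs with hc
  · -- above the threshold: `Ṽ ≤ N(U)`
    have hV : Vt ≤ U.map N := by
      intro z hz
      obtain ⟨hΘz, hz1, hzc⟩ := (hVt z).1 hz
      exact (mem_map_normHom_iff hvΘ hU hz1).2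
        (exists_mul_map_eq_of_thetaFixed_depth_of_le hσ' hfix' hπ' hdd' jK hjle hjΘ hjfix hjσ hjπ hD hFN hc hΘz hz1 hzc)
    exact (relIndex_comap_eq_div_two_of_le N hle h2 hV).1
  · -- below the threshold: `Ṽ ≰ N(U)`
    have hV : ¬ Vt ≤ U.map N := by
      intro hV
      obtain ⟨u, hΘu, hu1, hu, huN⟩ :=
        exists_thetaFixed_depth_not_norm_of_le hσ' hvσ' hfix' hπ' hdd' jK hjle hjfix hjσ hjπ hD (k := k) (by omega)
      have hu0 : u ≠ 0 := (Valuation.ne_zero_iff _).1 (by rw [hu1]; exact one_ne_zero)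
      have hmem : Units.mk0 u hu0 ∈ Vt :=
        (hVt _).2 ⟨by rw [Units.val_mk0]; exact hΘu, by rw [Units.val_mk0]; exact hu1, by rw [Units.val_mk0]; exact hu⟩
      exact huN ((mem_map_normHom_iff hvΘ hU (by rw [Units.val_mk0]; exact hu1)).1 (hV hmem) |>.imp fun ω hω => by
        rw [Units.val_mk0] at hω; exact hω)
    exact relIndex_comap_eq_of_not_le N hle h2 hVA hV

/-- **THE INDEX AT EVEN `K♮`-LEVEL `k = 2m`, EXPLICIT**: `[U : B] = if dΘ ≤ 2m + 1 then q^m ∕ 2 else q^m` (`q = #𝓀[K′]`; Mars' index `[Ũ : Ṽ] = q^m` ★ p857338).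
[cite: Serre1979, Ch. V §3 Cor. 3] [cite: Flicker1998UnitaryFL, Prop. 7 p. 84] -/
theorem relIndex_normDepth_eq_ite_pow_of_ramified [CompleteSpace K] [Finite 𝓀[K]] [IsDiscreteValuationRing 𝒪[K']] [Finite 𝓀[K']]
    (hσ' : ∀ x, σ' (σ' x) = x) (hvσ' : ∀ x, Valued.v (σ' x) = Valued.v x) (hfix' : ∀ x : K', σ' x = x → x ≠ 0 → ∃ n : ℤ, Valued.v x = exp (2 * n))
    (hπ' : Valued.v π' = exp (-1 : ℤ)) (hdd' : Valued.v (π' - σ' π') = Valued.v π' ^ d') {q : ℕ} (hq : Nat.card 𝓀[K'] = q)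
    (jK : K' →+* K) (hjle : ∀ x y : K', Valued.v (jK x) ≤ Valued.v (jK y) ↔ Valued.v x ≤ Valued.v y) (hjΘ : ∀ x, Θ (jK x) = jK x)
    (hjfix : ∀ z : K, Θ z = z → ∃ x, jK x = z) (hjσ : ∀ x, jK (σ' x) = ρ (jK x)) (hjπ : Valued.v (jK π') = exp (-2 : ℤ))
    {ϖ : K} {dΘ t : ℕ} (hD : IsRamifiedQuadraticDatum Θ ϖ dΘ t)
    (hFN : ∀ f : K, ρ f = f → Θ f = f → Valued.v f = 1 → ∃ x : K, x * Θ x = f)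
    (m : ℕ) (U Ut Vt B : Subgroup Kˣ) (hU : ∀ u, u ∈ U ↔ Valued.v (u : K) = 1)
    (hUt : ∀ z, z ∈ Ut ↔ Θ (z : K) = z ∧ Valued.v (z : K) = 1)
    (hVt : ∀ z, z ∈ Vt ↔ Θ (z : K) = z ∧ Valued.v (z : K) = 1 ∧ Valued.v ((z : K) - ρ z) ≤ Valued.v (jK π' ^ (d' + 2 * m)))
    (hB : ∀ ω, ω ∈ B ↔ Valued.v (ω : K) = 1 ∧ Valued.v ((ω : K) * Θ ω - ρ ((ω : K) * Θ ω)) ≤ Valued.v (jK π' ^ (d' + 2 * m))) :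
    B.relIndex U = if dΘ ≤ 2 * m + 1 then q ^ m / 2 else q ^ m := by
  rw [relIndex_normDepth_eq_ite_of_index_two_ramified hσ' hvσ' hfix' hπ' hdd' jK hjle hjΘ hjfix hjσ hjπ hD hFN (2 * m) U Ut Vt B hU hUt hVt hB,
    relIndex_thetaFixed_depth_eq_pow_of_le_iff hσ' hvσ' hfix' hπ' hdd' hq jK hjle hjΘ hjfix hjσ m Ut Vt hUt hVt]

/-- **THE INDEX AT ODD `K♮`-LEVEL `k = 2m + 1`, EXPLICIT**: `[U : B] = if dΘ ≤ 2m + 2 then q^{m+1} ∕ 2 else q^{m+1}` (Mars' index at odd levels ★ p857349 `…_odd_eq_pow`).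
[cite: Serre1979, Ch. V §3 Cor. 3] [cite: Flicker1998UnitaryFL, Prop. 7 p. 84] -/
theorem relIndex_normDepth_odd_eq_ite_pow_of_ramified [CompleteSpace K] [Finite 𝓀[K]] [IsDiscreteValuationRing 𝒪[K']] [Finite 𝓀[K']]
    (hσ' : ∀ x, σ' (σ' x) = x) (hvσ' : ∀ x, Valued.v (σ' x) = Valued.v x) (hfix' : ∀ x : K', σ' x = x → x ≠ 0 → ∃ n : ℤ, Valued.v x = exp (2 * n))
    (hπ' : Valued.v π' = exp (-1 : ℤ)) (hdd' : Valued.v (π' - σ' π') = Valued.v π' ^ d') {q : ℕ} (hq : Nat.card 𝓀[K'] = q)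
    (jK : K' →+* K) (hjle : ∀ x y : K', Valued.v (jK x) ≤ Valued.v (jK y) ↔ Valued.v x ≤ Valued.v y) (hjΘ : ∀ x, Θ (jK x) = jK x)
    (hjfix : ∀ z : K, Θ z = z → ∃ x, jK x = z) (hjσ : ∀ x, jK (σ' x) = ρ (jK x)) (hjπ : Valued.v (jK π') = exp (-2 : ℤ))
    {ϖ : K} {dΘ t : ℕ} (hD : IsRamifiedQuadraticDatum Θ ϖ dΘ t)
    (hFN : ∀ f : K, ρ f = f → Θ f = f → Valued.v f = 1 → ∃ x : K, x * Θ x = f)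
    (m : ℕ) (U Ut Vt B : Subgroup Kˣ) (hU : ∀ u, u ∈ U ↔ Valued.v (u : K) = 1)
    (hUt : ∀ z, z ∈ Ut ↔ Θ (z : K) = z ∧ Valued.v (z : K) = 1)
    (hVt : ∀ z, z ∈ Vt ↔ Θ (z : K) = z ∧ Valued.v (z : K) = 1 ∧ Valued.v ((z : K) - ρ z) ≤ Valued.v (jK π' ^ (d' + (2 * m + 1))))
    (hB : ∀ ω, ω ∈ B ↔ Valued.v (ω : K) = 1 ∧ Valued.v ((ω : K) * Θ ω - ρ ((ω : K) * Θ ω)) ≤ Valued.v (jK π' ^ (d' + (2 * m + 1)))) :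
    B.relIndex U = if dΘ ≤ 2 * m + 2 then q ^ (m + 1) / 2 else q ^ (m + 1) := by
  rw [relIndex_normDepth_eq_ite_of_index_two_ramified hσ' hvσ' hfix' hπ' hdd' jK hjle hjΘ hjfix hjσ hjπ hD hFN (2 * m + 1) U Ut Vt B hU hUt hVt hB,
    relIndex_thetaFixed_depth_odd_eq_pow hσ' hvσ' hfix' hπ' hdd' hq jK hjle hjΘ hjfix hjσ m Ut Vt hUt hVt]

/-- **LOW LEVELS: `B = U`** — at `M`-depth `|jK π′^n|` with `n ≤ d′` every unit `ω` has `|ωΘω − ρ(ωΘω)| ≤ |jK π′^{d′}| ≤ |jK π′^n|` (§1 `v_sub_map_le_pow_of_v_le_one` pulled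
back along `jK`), so `[U : B] = 1`. [cite: Serre1979, Ch. IV §1 Prop. 3–4] -/
theorem relIndex_normDepth_eq_one_of_le (hσ' : ∀ x, σ' (σ' x) = x)
    (hfix' : ∀ x : K', σ' x = x → x ≠ 0 → ∃ n : ℤ, Valued.v x = exp (2 * n)) (hπ' : Valued.v π' = exp (-1 : ℤ))
    (hdd' : Valued.v (π' - σ' π') = Valued.v π' ^ d') (jK : K' →+* K) (hjle : ∀ x y : K', Valued.v (jK x) ≤ Valued.v (jK y) ↔ Valued.v x ≤ Valued.v y)
    (hjfix : ∀ z : K, Θ z = z → ∃ x, jK x = z) (hjσ : ∀ x, jK (σ' x) = ρ (jK x)) (hΘΘ : ∀ x, Θ (Θ x) = x) (hvΘ : ∀ x, Valued.v (Θ x) = Valued.v x)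
    {n : ℕ} (hn : n ≤ d') (U B : Subgroup Kˣ) (hU : ∀ u, u ∈ U ↔ Valued.v (u : K) = 1)
    (hB : ∀ ω, ω ∈ B ↔ Valued.v (ω : K) = 1 ∧ Valued.v ((ω : K) * Θ ω - ρ ((ω : K) * Θ ω)) ≤ Valued.v (jK π' ^ n)) :
    B.relIndex U = 1 := by
  have hπ1 : Valued.v π' ≤ 1 := by rw [hπ', ← exp_zero, exp_le_exp]; norm_num
  have hBU : B = U := by
    ext ω
    rw [hB, hU]
    constructor
    · exact fun h => h.1
    · intro h1
      refine ⟨h1, ?_⟩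
      obtain ⟨z', hz'⟩ := hjfix ((ω : K) * Θ ω) (by rw [map_mul, hΘΘ, mul_comm])
      have hz1' : Valued.v z' ≤ 1 :=
        ((v_eq_one_iff_of_le_iff jK hjle z').1 (by rw [hz', map_mul, hvΘ, h1, mul_one])).le
      rw [← hz', ← hjσ, ← map_sub, v_map_le_iff_of_le_iff jK hjle]
      exact (v_sub_map_le_pow_of_v_le_one hσ' hfix' hπ' hdd' hz1').trans (pow_le_pow_right_of_le_one' hπ1 hn)
  rw [hBU, Subgroup.relIndex_self]

end Index

end Literature.NumberTheory.LocalFields.QuadraticOrder
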